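import Summits.QuantumAdvantage.QuantumAdvantage.Theorems.CylinderDialSplit
import Summits.QuantumAdvantage.QuantumAdvantage.Theorems.CodimDialRings
import HarnessLib

/-!
# CylinderDial, part 6: NECESSITY for `T := RingHardOdd 3` of the split items (support for item stmt-QuantumAdvantage-30910)

Cell decomp-qadv, seat lens-5, generation 13 — land port of §4c of the node «CylinderDial» rev 2 (parts 1–5 are in the
tree: `CylinderDialPieces/Split/Nand/Host/Log`).  Tags `N(T)`: `SpreadLossJ3`, `JCover3`, `JBridge3` (the two halves of the
exact split `pureCover3_iff_jPieces`) and `PureCover3` itself follow from `RingHardOdd 3` (tree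
`CodimDial.linSpread3_of_ringHardOdd`, `CodimDial.spreadLoss3_of_linSpread3`); for every class `K`, `KCover3 K` and
`KBridge3 K` do.  The side pieces `CylTameJ3` (victim-free law) and `CylCover3` (relative spread on cylinders) carry NO
necessity theorem — they are SUFFICIENT-side attack statements (critic row 74v3), `CylCover3` being the `p = 3` analogue of
the tree's `AffBells22.walkHardAllSubcube`, PROVED only in the base range (`CylinderDialLog`).
No `sorry`, no new axioms, no instances, no notation; Prop-free.
-/

set_option linter.style.longLine false
set_option linter.dupNamespace false

namespace Summit.QuantumAdvantage.QuantumAdvantage.Theorems.CylinderDial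

open Finset
open Literature.Computability.QuantumComplexity Literature.Computability.QuantumComplexity.RingHLF
open Literature.Computability.MetaComplexity
open Summit.QuantumAdvantage.AdviceFreeQNC0
open Summit.QuantumAdvantage.QuantumAdvantage.Theses

section Necessity

/-! ### §4c  Necessity for `T := RingHardOdd 3` of the class-relative pieces (tags `N(T)`): the split items `JCover3`,
`JBridge3` and the restricted target `SpreadLossJ3` follow from `T` (tree `CodimDial.linSpread3_of_ringHardOdd`,
`CodimDial.spreadLoss3_of_linSpread3`).  The side pieces are NOT of this kind: `CylTameJ3` is victim-free (a structure
law, neither implied by nor implying anything about `T`), and `CylCover3` — relative spread of the victim's loss on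
cylinders with up to `n/2` frozen coordinates — is NOT known to follow from `T` (it is the `p = 3` analogue of the tree's
`AffBells22.walkHardAllSubcube`; PROVED only in the base range, §8 of the lineage record / `CylinderDialLog.lean`). -/

/-- CylinderDialNecessity helper `spreadLoss3_of_ringHardOdd` (decomp-qadv land package; see the module docstring). -/
theorem spreadLoss3_of_ringHardOdd (h : RingHardOdd 3) : SpreadDial.SpreadLoss3 :=
  Theorems.CodimDial.spreadLoss3_of_linSpread3 (Theorems.CodimDial.linSpread3_of_ringHardOdd h)

/-- CylinderDialNecessity helper `spreadLossK3_of_ringHardOdd` (decomp-qadv land package; see the module docstring). -/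
theorem spreadLossK3_of_ringHardOdd (K : SysClass) (h : RingHardOdd 3) : SpreadLossK3 K :=
  spreadLossK3_of_spreadLoss3 K (spreadLoss3_of_ringHardOdd h)

/-- CylinderDialNecessity helper `kCover3_of_ringHardOdd` (decomp-qadv land package; see the module docstring). -/
theorem kCover3_of_ringHardOdd (K : SysClass) (h : RingHardOdd 3) : KCover3 K :=
  fun _ _ => spreadLossK3_of_ringHardOdd K h

/-- CylinderDialNecessity helper `kBridge3_of_ringHardOdd` (decomp-qadv land package; see the module docstring). -/
theorem kBridge3_of_ringHardOdd (K : SysClass) (h : RingHardOdd 3) : KBridge3 K :=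
  fun _ _ => spreadLoss3_of_ringHardOdd h

/-- `N(T)`: `SpreadLossJ3`, `JCover3`, `JBridge3` are consequences of `RingHardOdd 3`. -/
theorem spreadLossJ3_of_ringHardOdd (h : RingHardOdd 3) : SpreadLossJ3 := spreadLossK3_of_ringHardOdd Junta h

/-- CylinderDialNecessity helper `jCover3_of_ringHardOdd` (decomp-qadv land package; see the module docstring). -/
theorem jCover3_of_ringHardOdd (h : RingHardOdd 3) : JCover3 := kCover3_of_ringHardOdd Junta h

/-- CylinderDialNecessity helper `jBridge3_of_ringHardOdd` (decomp-qadv land package; see the module docstring). -/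
theorem jBridge3_of_ringHardOdd (h : RingHardOdd 3) : JBridge3 := kBridge3_of_ringHardOdd Junta h

/-- and `PureCover3` itself is `N(T)` (both halves are). -/
theorem pureCover3_of_ringHardOdd (h : RingHardOdd 3) : SpreadDial.PureCover3 :=
  pureCover3_of_pieces' (jCover3_of_ringHardOdd h) (jBridge3_of_ringHardOdd h)
where
  /-- the exact split, assembled -/
  pureCover3_of_pieces' (hJ : JCover3) (hB : JBridge3) : SpreadDial.PureCover3 := (pureCover3_iff_jPieces).mpr ⟨hJ, hB⟩

end Necessity

end Summit.QuantumAdvantage.QuantumAdvantage.Theorems.CylinderDial
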